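import Summits.BirchSwinnertonDyer.Rank1Residual.ManinAdditive.KummerCubeMonodromy
import Literature.NumberTheory.EllipticCurves.WeierstrassSigmaProofs
import Literature.NumberTheory.EllipticCurves.WeierstrassZetaLegendre
import Literature.NumberTheory.EllipticCurves.WeierstrassTorsion
import Literature.NumberTheory.EllipticCurves.WeierstrassPMultiplication
import Literature.NumberTheory.EllipticCurves.RealLatticePeriodHalfPeriodsProofs
import Literature.NumberTheory.EllipticCurves.ComplexTorus
import Literature.NumberTheory.EllipticCurves.EichlerIntegralWeierstrassProofs
import Literature.NumberTheory.EllipticCurves.ModularSymbolsLattice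
import HarnessLib

/-!
# Preliminaries for leaf S4 `SigmaCubeRootMonodromy` of the `σ`-monodromy line (T-an-40 (d), part 1 of 2)
# (route `ManinLocalTwoThree`, crux C3 `ManinPrimeToThreeAtNine` stmt-BirchSwinnertonDyer-22968; cell bsd-f2-manin: proofs by planner
# `-an` g37 — HOME/an/g37/KummerSigmaMonodromyLeaves-an-g37.lean sha16 605035015c928e28 — landed verbatim up to namespace by p2 gen 16
# per the -ty g20 12:58Z routing; MEMO-an §80.9)

General-purpose lemmas used by `Theorems/ManinLocalTwoThreeKummerCubeSigmaMonodromy.lean` (the proof of S4):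
* `sigmaCubeRoot_add_ω₁ / _add_ω₂`, `sigmaCubeRoot_add_of_mem_lattice` — the `σ`-cube root
  `W_{a,e}(w) = e^{ew/3}σ(w − a)/σ(w)` has a constant non-zero multiplier under every lattice translation
  (`W(w + ωᵢ) = exp((eωᵢ − 3aηᵢ)/3)·W(w)`, junk values included; the set of such translations is a subgroup);
* `cexp_int_mul_div_three_ne_one` — `exp(m·(±2πi)/3) ≠ 1` for `3 ∤ m`;
* `exists_entire_weierstrassP_sigma` — the ENTIRE functions `P₂ = σ'² − σσ''` (`= ℘σ²` off `Λ`) and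
  `P₃ = σP₂' − 2σ'P₂` (`= ℘'σ³` off `Λ`), from `ζ = σ'/σ`, `℘ = −ζ'`;
* `eventually_eichlerIntegral_affine_notMem` — for `f ≠ 0`, `α ≠ 0` the values `α·2πi∫^z f + β` avoid `Λ` on a punctured
  neighbourhood of every point of the upper half-plane (`u` holomorphic, nowhere locally constant; `Λ` discrete);
* `eventually_modularForm_ne_zero` — a non-zero modular form is non-zero on a punctured neighbourhood of every point
  (identity theorem on the connected half-plane).
HONEST FRAMING: routine complex analysis; nothing about BSD or Manin's conjecture is proved; C3 remains OPEN.
[cite: WhittakerWatson1927, §20.421 (σ quasi-periodicity), §20.2 (ζ = σ'/σ, ℘ = −ζ')]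
-/

set_option autoImplicit false
-- lint-debt: the directory name repeats the summit name (sibling precedent `ManinLocalTwoThreeKummerCubeSigmaLeaves.lean`)
set_option linter.dupNamespace false

noncomputable section

open Complex Filter Topology
open scoped PeriodPair UpperHalfPlane
open WeierstrassCurve Literature.NumberTheory.EllipticCurves Literature.NumberTheory.EllipticCurves.ModularForms
open Summit.BirchSwinnertonDyer.Rank1Residual.ManinAdditive.CuspidalKummer
open Summit.BirchSwinnertonDyer.Rank1Residual.ManinAdditive.CuspidalKummerThree
open Summit.BirchSwinnertonDyer.Rank1Residual.ManinAdditive.KummerCubeMonodromy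

namespace Summit.BirchSwinnertonDyer.BirchSwinnertonDyer.Theorems.ManinLocalTwoThree.KummerCubeSigmaLeaves

/-! ### Multipliers of the `σ`-cube root -/

/-- `W_{a,e}(w + ω₁) = exp((eω₁ − 3aη₁)/3)·W_{a,e}(w)` (quasi-periodicity of `σ`; holds at the junk values too).
[cite: WhittakerWatson1927, §20.421] -/
theorem sigmaCubeRoot_add_ω₁ (L : PeriodPair) (a e w : ℂ) :
    sigmaCubeRoot L a e (w + L.ω₁) = cexp ((e * L.ω₁ - 3 * a * L.η₁) / 3) * sigmaCubeRoot L a e w := by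
  unfold sigmaCubeRoot
  rw [show w + L.ω₁ - a = (w - a) + L.ω₁ by ring, L.weierstrassSigma_add_ω₁_holds (w - a),
    L.weierstrassSigma_add_ω₁_holds w]
  by_cases hw : L.weierstrassSigma w = 0
  · simp [hw]
  rw [show e * (w + L.ω₁) / 3 = e * w / 3 + (e * L.ω₁ - 3 * a * L.η₁) / 3 + L.η₁ * a by ring,
    show L.η₁ * ((w - a) + L.ω₁ / 2) = L.η₁ * (w + L.ω₁ / 2) - L.η₁ * a by ring,
    Complex.exp_add, Complex.exp_add, Complex.exp_sub]
  have h1 : cexp (L.η₁ * (w + L.ω₁ / 2)) ≠ 0 := Complex.exp_ne_zero _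
  have h2 : cexp (L.η₁ * a) ≠ 0 := Complex.exp_ne_zero _
  field_simp

/-- `W_{a,e}(w + ω₂) = exp((eω₂ − 3aη₂)/3)·W_{a,e}(w)`. [cite: WhittakerWatson1927, §20.421] -/
theorem sigmaCubeRoot_add_ω₂ (L : PeriodPair) (a e w : ℂ) :
    sigmaCubeRoot L a e (w + L.ω₂) = cexp ((e * L.ω₂ - 3 * a * L.η₂) / 3) * sigmaCubeRoot L a e w := by
  unfold sigmaCubeRoot
  rw [show w + L.ω₂ - a = (w - a) + L.ω₂ by ring, L.weierstrassSigma_add_ω₂_holds (w - a),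
    L.weierstrassSigma_add_ω₂_holds w]
  by_cases hw : L.weierstrassSigma w = 0
  · simp [hw]
  rw [show e * (w + L.ω₂) / 3 = e * w / 3 + (e * L.ω₂ - 3 * a * L.η₂) / 3 + L.η₂ * a by ring,
    show L.η₂ * ((w - a) + L.ω₂ / 2) = L.η₂ * (w + L.ω₂ / 2) - L.η₂ * a by ring,
    Complex.exp_add, Complex.exp_add, Complex.exp_sub]
  have h1 : cexp (L.η₂ * (w + L.ω₂ / 2)) ≠ 0 := Complex.exp_ne_zero _
  have h2 : cexp (L.η₂ * a) ≠ 0 := Complex.exp_ne_zero _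
  field_simp

/-- `exp(m·s/3) ≠ 1` for `s = ±2πi` and `3 ∤ m`. [folklore] -/
theorem cexp_int_mul_div_three_ne_one (m : ℤ) (s : ℂ)
    (hs : s = 2 * Real.pi * I ∨ s = -(2 * Real.pi * I)) (hm : ¬ (3 : ℤ) ∣ m) :
    cexp ((m : ℂ) * s / 3) ≠ 1 := by
  intro h
  obtain ⟨n, hn⟩ := Complex.exp_eq_one_iff.mp h
  have h2pi : (2 * Real.pi * I : ℂ) ≠ 0 := by
    have hπ : (Real.pi : ℂ) ≠ 0 := by exact_mod_cast Real.pi_ne_zero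
    simp [hπ, Complex.I_ne_zero]
  rcases hs with hs | hs
  · rw [hs] at hn
    have h3 : (m : ℂ) * (2 * Real.pi * I) = (3 * n) * (2 * Real.pi * I) := by linear_combination 3 * hn
    have hm3 : (m : ℂ) = 3 * n := mul_right_cancel₀ h2pi h3
    have : m = 3 * n := by exact_mod_cast hm3
    exact hm ⟨n, this⟩
  · rw [hs] at hn
    have h3 : (m : ℂ) * (2 * Real.pi * I) = (3 * (-n)) * (2 * Real.pi * I) := by linear_combination -3 * hn
    have hm3 : (m : ℂ) = 3 * (-n) := mul_right_cancel₀ h2pi h3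
    have : m = 3 * (-n) := by exact_mod_cast hm3
    exact hm ⟨-n, this⟩

section S4prelims

open UpperHalfPlane CongruenceSubgroup
open scoped MatrixGroups ModularForm


/-- The `σ`-cube root has a constant non-zero multiplier under every lattice translation. [folklore] -/
theorem sigmaCubeRoot_add_of_mem_lattice (L : PeriodPair) (a e : ℂ) {μ : ℂ} (hμ : μ ∈ L.lattice) :
    ∃ ρ : ℂ, ρ ≠ 0 ∧ ∀ w : ℂ, sigmaCubeRoot L a e (w + μ) = ρ * sigmaCubeRoot L a e w := by
  let S : AddSubgroup ℂ :=
    { carrier := {μ | ∃ ρ : ℂ, ρ ≠ 0 ∧ ∀ w : ℂ, sigmaCubeRoot L a e (w + μ) = ρ * sigmaCubeRoot L a e w}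
      zero_mem' := ⟨1, one_ne_zero, fun w ↦ by simp⟩
      add_mem' := by
        rintro μ₁ μ₂ ⟨ρ₁, hρ₁, h₁⟩ ⟨ρ₂, hρ₂, h₂⟩
        refine ⟨ρ₂ * ρ₁, mul_ne_zero hρ₂ hρ₁, fun w ↦ ?_⟩
        rw [show w + (μ₁ + μ₂) = (w + μ₁) + μ₂ by ring, h₂, h₁, mul_assoc]
      neg_mem' := by
        rintro μ ⟨ρ, hρ, h⟩
        refine ⟨ρ⁻¹, inv_ne_zero hρ, fun w ↦ ?_⟩
        have := h (w + -μ)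
        rw [show w + -μ + μ = w by ring] at this
        rw [this, inv_mul_cancel_left₀ hρ] }
  have h₁ : L.ω₁ ∈ S := ⟨_, Complex.exp_ne_zero _, sigmaCubeRoot_add_ω₁ L a e⟩
  have h₂ : L.ω₂ ∈ S := ⟨_, Complex.exp_ne_zero _, sigmaCubeRoot_add_ω₂ L a e⟩
  obtain ⟨m, n, hmn⟩ := PeriodPair.mem_lattice.mp hμ
  have hmem : μ ∈ S := by
    rw [← hmn]
    refine S.add_mem ?_ ?_
    · simpa [zsmul_eq_mul] using S.zsmul_mem h₁ m
    · simpa [zsmul_eq_mul] using S.zsmul_mem h₂ n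
  exact hmem

/-- **`℘σ²` and `℘'σ³` are entire**: `P₂ = σ'² − σσ''` and `P₃ = σP₂' − 2σ'P₂` (from `ζ = σ'/σ`, `℘ = −ζ'`).
[folklore] -/
theorem exists_entire_weierstrassP_sigma (L : PeriodPair) :
    ∃ P₂ P₃ : ℂ → ℂ, Differentiable ℂ P₂ ∧ Differentiable ℂ P₃ ∧
      (∀ w, w ∉ L.lattice → P₂ w = ℘[L] w * L.weierstrassSigma w ^ 2) ∧
      (∀ w, w ∉ L.lattice → P₃ w = ℘'[L] w * L.weierstrassSigma w ^ 3) := by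
  have hσ : Differentiable ℂ L.weierstrassSigma := L.differentiable_weierstrassSigma_holds
  have hσ' : Differentiable ℂ (deriv L.weierstrassSigma) := fun z ↦
    ((hσ.analyticAt z).deriv).differentiableAt
  have hσ'' : Differentiable ℂ (deriv (deriv L.weierstrassSigma)) := fun z ↦
    ((hσ.analyticAt z).deriv.deriv).differentiableAt
  have hopen : IsOpen ((L.lattice : Set ℂ)ᶜ) := L.isClosed_lattice.isOpen_compl
  have hσne : ∀ w, w ∉ L.lattice → L.weierstrassSigma w ≠ 0 := fun w hw h ↦
    hw ((L.weierstrassSigma_eq_zero_iff_holds w).mp h)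
  obtain ⟨P₂, hP₂def⟩ : ∃ P₂ : ℂ → ℂ, P₂ = fun w ↦
      deriv L.weierstrassSigma w ^ 2 - L.weierstrassSigma w * deriv (deriv L.weierstrassSigma) w := ⟨_, rfl⟩
  have hP₂ : Differentiable ℂ P₂ := by rw [hP₂def]; exact (hσ'.pow 2).sub (hσ.mul hσ'')
  have hP₂' : Differentiable ℂ (deriv P₂) := fun z ↦ ((hP₂.analyticAt z).deriv).differentiableAt
  have hP₂eq : ∀ w, w ∉ L.lattice → P₂ w = ℘[L] w * L.weierstrassSigma w ^ 2 := by
    intro w hw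
    have hne := hσne w hw
    have hζ : L.weierstrassZeta =ᶠ[𝓝 w] fun u ↦ deriv L.weierstrassSigma u / L.weierstrassSigma u := by
      filter_upwards [hopen.mem_nhds hw] with u hu
      have := L.logDeriv_weierstrassSigma_holds u hu
      rw [logDeriv_apply] at this
      exact this.symm
    have h℘ : ℘[L] w = -deriv L.weierstrassZeta w := by
      rw [L.deriv_weierstrassZeta_holds w hw, neg_neg]
    have hquot : HasDerivAt (fun u ↦ deriv L.weierstrassSigma u / L.weierstrassSigma u)
        ((deriv (deriv L.weierstrassSigma) w * L.weierstrassSigma w -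
          deriv L.weierstrassSigma w * deriv L.weierstrassSigma w) / L.weierstrassSigma w ^ 2) w :=
      (hσ' w).hasDerivAt.div (hσ w).hasDerivAt hne
    rw [h℘, hζ.deriv_eq, hquot.deriv, hP₂def]
    field_simp
    ring
  obtain ⟨P₃, hP₃def⟩ : ∃ P₃ : ℂ → ℂ, P₃ = fun w ↦
      L.weierstrassSigma w * deriv P₂ w - 2 * deriv L.weierstrassSigma w * P₂ w := ⟨_, rfl⟩
  have hP₃ : Differentiable ℂ P₃ := by
    rw [hP₃def]; exact (hσ.mul hP₂').sub ((hσ'.const_mul 2).mul hP₂)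
  refine ⟨P₂, P₃, hP₂, hP₃, hP₂eq, fun w hw ↦ ?_⟩
  have heq : P₂ =ᶠ[𝓝 w] fun u ↦ ℘[L] u * L.weierstrassSigma u ^ 2 := by
    filter_upwards [hopen.mem_nhds hw] with u hu using hP₂eq u hu
  have hd : HasDerivAt (fun u ↦ ℘[L] u * L.weierstrassSigma u ^ 2)
      (℘'[L] w * L.weierstrassSigma w ^ 2 +
        ℘[L] w * ((2 : ℕ) * L.weierstrassSigma w ^ (2 - 1) * deriv L.weierstrassSigma w)) w :=
    (L.hasDerivAt_weierstrassP hw).mul ((hσ w).hasDerivAt.pow 2)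
  rw [hP₃def]
  simp only
  rw [heq.deriv_eq, hd.deriv, hP₂eq w hw]
  push_cast
  ring

/-- **Generic points**: for `f ≠ 0`, `α ≠ 0`, the values `α·2πi∫^z f + β` avoid the lattice on a punctured
neighbourhood of every point of the upper half-plane (`u` is holomorphic and nowhere locally constant, `Λ` is
discrete). [folklore] -/
theorem eventually_eichlerIntegral_affine_notMem {N : ℕ} [NeZero N] (f : CuspForm (Gamma0 N) 2) (hf : f ≠ 0)
    (L : PeriodPair) {z₀ : ℂ} (hz₀ : 0 < z₀.im) {α : ℂ} (hα : α ≠ 0) (β : ℂ) :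
    ∀ᶠ z in 𝓝[≠] z₀, α * eichlerIntegral f (ofComplex z) + β ∉ L.lattice := by
  obtain ⟨U, hU⟩ : ∃ U : ℂ → ℂ, U = fun w ↦ α * eichlerIntegral f (ofComplex w) + β := ⟨_, rfl⟩
  have han : AnalyticAt ℂ U z₀ := by
    rw [hU]
    exact (analyticAt_const.mul (analyticAt_eichlerIntegral_comp_ofComplex f hz₀)).add analyticAt_const
  have h1 : ∀ᶠ w in 𝓝 z₀, U w ∈ ((L.lattice : Set ℂ) \ {U z₀})ᶜ :=
    han.continuousAt.preimage_mem_nhds (L.compl_lattice_sdiff_singleton_mem_nhds (U z₀))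
  have h2 : ∀ᶠ w in 𝓝[≠] z₀, U w ≠ U z₀ := by
    have han' : AnalyticAt ℂ (fun w ↦ U w - U z₀) z₀ := han.sub analyticAt_const
    rcases han'.eventually_eq_zero_or_eventually_ne_zero with h | h
    · exfalso
      apply not_eventually_const_eichlerIntegral f hf hz₀ (eichlerIntegral f (ofComplex z₀))
      filter_upwards [h] with w hw
      rw [hU] at hw
      have h0 : α * (eichlerIntegral f (ofComplex w) - eichlerIntegral f (ofComplex z₀)) = 0 := by
        linear_combination hw
      simpa [hα, sub_eq_zero] using h0
    · filter_upwards [h] with w hw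
      simpa [sub_eq_zero] using hw
  filter_upwards [h2, nhdsWithin_le_nhds h1] with w hw2 hw1
  rw [hU] at hw1 hw2
  exact fun hw ↦ hw1 ⟨hw, hw2⟩

/-- **Generic non-vanishing** of a non-zero modular form on a punctured neighbourhood (identity theorem on the
connected half-plane). [folklore] -/
theorem eventually_modularForm_ne_zero {M : ℕ} {k : ℤ} (G : ModularForm (Gamma0 M) k) (hG : G ≠ 0)
    {z₀ : ℂ} (hz₀ : 0 < z₀.im) : ∀ᶠ z in 𝓝[≠] z₀, G (ofComplex z) ≠ 0 := by
  have hdiff : DifferentiableOn ℂ (⇑G ∘ ofComplex) {z : ℂ | 0 < z.im} :=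
    UpperHalfPlane.mdifferentiable_iff.mp (ModularFormClass.holo G)
  have han : AnalyticOnNhd ℂ (⇑G ∘ ofComplex) {z : ℂ | 0 < z.im} :=
    hdiff.analyticOnNhd isOpen_upperHalfPlaneSet
  rcases (han z₀ hz₀).eventually_eq_zero_or_eventually_ne_zero with h | h
  · exfalso
    apply hG
    have hEq : Set.EqOn (⇑G ∘ ofComplex) 0 {z : ℂ | 0 < z.im} :=
      han.eqOn_zero_of_preconnected_of_eventuallyEq_zero convex_setOf_im_pos.isPreconnected hz₀ h
    apply DFunLike.ext
    intro τ
    have := hEq τ.im_pos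
    simpa [ofComplex_apply] using this
  · exact h

end S4prelims

end Summit.BirchSwinnertonDyer.BirchSwinnertonDyer.Theorems.ManinLocalTwoThree.KummerCubeSigmaLeaves

end
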